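import Summits.BirchSwinnertonDyer.BirchSwinnertonDyer.Theorems.EdixhovenFibreFiveSevenReceptacleCyclotomicCompletion
import Summits.BirchSwinnertonDyer.BirchSwinnertonDyer.Theorems.TeichmullerTwistDescentLocalPTorsionLine
import HarnessLib

/-!
# The receptacle exit in (S5b)'s LITERAL currency: the model `W.baseChange K` (not `curveK p K (W_ℤ ⊗ ℤ_p)`) —
# `curveK p K (W_ℤ ⊗ ℤ_p) = W.baseChange K`, transport of the trace condition, and the exit at `K` and at `K_w`

Route `EdixhovenFibreFiveSeven`, crux K★ `StarredOptimalManinUnitFiveSeven` (stmt-BirchSwinnertonDyer-22226),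
line `kato-lever`, seat `bsd-line-edix-p2` g4; `--supports` 22226 (helper toward the ONE open stub F″ =
`Literature.NumberTheory.EllipticCurves.kato_neron_isIntegral_twistedSymbolSum_of_additive_five_le`). TOOL theorems only
(no definition, no named fact, no `sorry`); nothing is closed or booked; BSD is not proved by any of this.

WHY. The cite-only Tate-duality fact (S5b) `PAdicHodge.exists_smul_range_expStarCoord_iff_trace_log` characterises the range of
`exp*_{e•ω}` on `H¹(F, T_pW)` by `∀ P : (W.baseChange F).toAffine.Point, ‖Tr_{F/ℚ_p}(a · padicLogPointFiniteExt w (W.baseChange F) p P)‖ ≤ 1`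
— stated on Mathlib's `W.baseChange F` for a valuation `w` on `F`. This seat's receptacle exit (p599280
`ReceptacleTorsion.norm_le_one_of_forall_point_Kw_of_katoClause`, with p598658 / edix-p5's p598030 / edix-p1's p596837 behind
it) is stated on the K-port model `BallEval.curveK p K (W_ℤ ⊗ ℤ_p)` with the norm valuation. THIS file removes the last
syntactic gap: the two Weierstrass curves over `K` are EQUAL (`ℤ → K` is the unique ring map; ttd-p1's
`map_integralModelInt_eq_baseChange`), the trace condition transports along `Affine.Point.congrEquiv`, and the exit is restated
with (S5b)'s literal right-hand side at `F := K` (abstract) and `F := K_w = KPort.Kw p L w` (cyclotomic completion), `w :=` the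
norm valuation. What the assembler of «F″ ⟸ P1» then needs at the receptacle is only to instantiate (S5b) at `F := K_w` with
`NormedField.valuation` as its compatible valuation.

* §1 `curveK_integralModelInt_eq_baseChange` (`curveK p K (W_ℤ ⊗ ℤ_p) = W.baseChange K`),
  `padicLogPointFiniteExt_congrEquiv` (log along an equality of curves), `forall_trace_curveK_of_forall_trace_baseChange`.
* §2 `norm_le_one_of_forall_point_baseChange_of_addv_of_katoClause` (abstract `K`),
  ★ `norm_le_one_of_forall_point_baseChange_Kw_of_katoClause` (at `K_w`, F″'s clause as typed) and their (S5b)-socket forms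
  `forall_norm_le_one_of_range_iff_forall_point_baseChange_{of_addv_of_katoClause,Kw_of_katoClause}`.

References: [KimNakamura2020] C.-H. Kim, K. Nakamura, J. Number Theory 210 (2020), Cor. 2.4; [BlochKato1990] Prop. 3.8;
[Kato1993LNM1553] Ch. II Thm. 1.4.1 (the content of (S5b)); [SilvermanAEC2009] VII.2, IV.6.4.
-/

set_option autoImplicit false
-- the Theorems namespace of a single-conjunct summit repeats the summit name by design (D-0017)
set_option linter.dupNamespace false

noncomputable section

open scoped Classical NNReal NumberField
open WeierstrassCurve Literature.NumberTheory.EllipticCurves Literature.NumberTheory.EllipticCurves.FormalGroupChart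
open Summit.BirchSwinnertonDyer.Rank1Residual.Additive
open Summit.BirchSwinnertonDyer.Rank1Residual.Additive.BallEval
open Summit.BirchSwinnertonDyer.BirchSwinnertonDyer.Theorems.KPort
open Literature.NumberTheory.GaloisRepresentations.LubinTate (unitBall mem_unitBall_iff)
open IsDedekindDomain NumberField

namespace Summit.BirchSwinnertonDyer.BirchSwinnertonDyer.Theorems.ReceptacleTorsion

/-! ## §1 `curveK p K (W_ℤ ⊗ ℤ_p) = W.baseChange K` and transport of the trace condition -/

section Bridge

variable {p : ℕ} [hp : Fact p.Prime] {K : Type*} [NontriviallyNormedField K] [NormedAlgebra ℚ_[p] K]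
  [IsUltrametricDist K] [Algebra ℚ K] (W : WeierstrassCurve ℚ) [W.IsGloballyMinimal]

/-- **`curveK p K (W_ℤ ⊗ ℤ_p) = W ⊗ K`**: the K-port model of the minimal model of `W/ℚ` over a normed `ℚ_p`-field `K` IS
Mathlib's base change `W.baseChange K`, for ANY `ℚ`-algebra structure on `K` (`ℤ → K` is the unique ring map; ttd-p1's
`map_integralModelInt_eq_baseChange`). [folklore] -/
theorem curveK_integralModelInt_eq_baseChange :
    curveK p K ((integralModelInt W).map (Int.castRingHom ℤ_[p])) = W.baseChange K := by
  rw [← TeichmullerTwistDescent.LocalPTorsionLine.map_integralModelInt_eq_baseChange W K, curveK,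
    WeierstrassCurve.map_map]
  exact congrArg (integralModelInt W).map (RingHom.ext_int _ _)

omit [NormedAlgebra ℚ_[p] K] [IsUltrametricDist K] [Algebra ℚ K] hp in
/-- `log_ω` along an EQUALITY of Weierstrass equations (identity on coordinates). [folklore] -/
theorem padicLogPointFiniteExt_congrEquiv (v : Valuation K ℝ≥0) {C₁ C₂ : WeierstrassCurve K} (h : C₁ = C₂)
    [h₁ : C₁.IsIntegral v.integer] [h₂ : C₂.IsIntegral v.integer] (P : C₁.toAffine.Point) :
    padicLogPointFiniteExt v C₂ p (Affine.Point.congrEquiv h P) = padicLogPointFiniteExt v C₁ p P := by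
  subst h
  rfl

/-- **Transport of (S5b)'s trace condition** from `W.baseChange K` (its literal model) to the K-port model
`curveK p K (W_ℤ ⊗ ℤ_p)` (the receptacle's model), norm valuation on both sides. [folklore] -/
theorem forall_trace_curveK_of_forall_trace_baseChange
    [h₁ : (W.baseChange K).IsIntegral (NormedField.valuation (K := K)).integer]
    [h₂ : (curveK p K ((integralModelInt W).map (Int.castRingHom ℤ_[p]))).IsIntegral (NormedField.valuation (K := K)).integer]
    {a : K}
    (ha : ∀ P : (W.baseChange K).toAffine.Point,
      ‖Algebra.trace ℚ_[p] K (a * padicLogPointFiniteExt (NormedField.valuation (K := K)) (W.baseChange K) p P)‖ ≤ 1) :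
    ∀ P : (curveK p K ((integralModelInt W).map (Int.castRingHom ℤ_[p]))).toAffine.Point,
      ‖Algebra.trace ℚ_[p] K (a * padicLogPointFiniteExt (NormedField.valuation (K := K))
        (curveK p K ((integralModelInt W).map (Int.castRingHom ℤ_[p]))) p P)‖ ≤ 1 := by
  intro P
  have h := curveK_integralModelInt_eq_baseChange (p := p) (K := K) W
  have e := padicLogPointFiniteExt_congrEquiv (p := p) (NormedField.valuation (K := K)) h P
  rw [← e]
  exact ha _

end Bridge

/-! ## §2 The exit with (S5b)'s literal right-hand side: abstract unramified Galois `K`, and `K_w` -/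

section ExitAbstract

variable {p : ℕ} [hp : Fact p.Prime] {K : Type*} [NontriviallyNormedField K] [NormedAlgebra ℚ_[p] K]
  [IsUltrametricDist K] [CompleteSpace K] [FiniteDimensional ℚ_[p] K] [IsGalois ℚ_[p] K] [Algebra ℚ K]
  (W : WeierstrassCurve ℚ) [W.IsElliptic] [W.IsGloballyMinimal]
  [h₁ : (W.baseChange K).IsIntegral (NormedField.valuation (K := K)).integer]

/-- ★ **RECEPTACLE EXIT in (S5b)'s literal currency, abstract `K`.** `W/ℚ` globally minimal, `Addv W p`, `5 ≤ p`, `K/ℚ_p`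
finite Galois UNRAMIFIED, F″'s clause (`finrank` form): if `‖Tr_{K/ℚ_p}(a · padicLogPointFiniteExt ‖·‖ (W.baseChange K) p P)‖ ≤ 1`
for every `P : (W.baseChange K).toAffine.Point` — the right-hand side of `PAdicHodge.exists_smul_range_expStarCoord_iff_trace_log`
at `F := K`, `w := NormedField.valuation` — then `‖a‖ ≤ 1`. [cite: KimNakamura2020, Cor. 2.4] [cite: KostersPannekoek2017, Thm. 1 and Cor. 2] -/
theorem norm_le_one_of_forall_point_baseChange_of_addv_of_katoClause (hp5 : 5 ≤ p) (hadd : Rank1Residual.Addv W p)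
    (hK : ∀ z : K, ‖z‖ < 1 → ‖z‖ ≤ ‖(p : K)‖)
    (hcl : 7 < p ∨ (Nat.Coprime (Module.finrank ℚ_[p] K) (p - 1) ∧
      ∀ P : (W.baseChange ℚ_[p]).toAffine.Point, p • P = 0 → P = 0))
    {a : K}
    (ha : ∀ P : (W.baseChange K).toAffine.Point,
      ‖Algebra.trace ℚ_[p] K (a * padicLogPointFiniteExt (NormedField.valuation (K := K)) (W.baseChange K) p P)‖ ≤ 1) :
    ‖a‖ ≤ 1 := by
  haveI := isIntegral_curveK p K ((integralModelInt W).map (Int.castRingHom ℤ_[p]))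
  exact norm_le_one_of_forall_point_of_addv_of_katoClause W hp5 hadd hK hcl
    (forall_trace_curveK_of_forall_trace_baseChange (p := p) W ha)

/-- (S5b)-socket form, abstract `K`: any `Φ : X → K` whose range is characterised by (S5b)'s literal condition on
`W.baseChange K` takes values in `𝒪_K` — `exp*_{e•ω}(H¹(K, T_pW)) ⊆ 𝒪_K`. [cite: KimNakamura2020, Cor. 2.4] [cite: BlochKato1990, Prop. 3.8] -/
theorem forall_norm_le_one_of_range_iff_forall_point_baseChange_of_addv_of_katoClause (hp5 : 5 ≤ p)
    (hadd : Rank1Residual.Addv W p) (hK : ∀ z : K, ‖z‖ < 1 → ‖z‖ ≤ ‖(p : K)‖)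
    (hcl : 7 < p ∨ (Nat.Coprime (Module.finrank ℚ_[p] K) (p - 1) ∧
      ∀ P : (W.baseChange ℚ_[p]).toAffine.Point, p • P = 0 → P = 0))
    {X : Type*} (Φ : X → K)
    (hΦ : ∀ a : K, (∃ x, Φ x = a) ↔ ∀ P : (W.baseChange K).toAffine.Point,
      ‖Algebra.trace ℚ_[p] K (a * padicLogPointFiniteExt (NormedField.valuation (K := K)) (W.baseChange K) p P)‖ ≤ 1)
    (x : X) : ‖Φ x‖ ≤ 1 :=
  norm_le_one_of_forall_point_baseChange_of_addv_of_katoClause W hp5 hadd hK hcl ((hΦ (Φ x)).mp ⟨x, rfl⟩)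

end ExitAbstract

section ExitKw

variable (p : ℕ) [hp : Fact p.Prime] (L : Type) [Field L] [NumberField L]
  (w : ((Rat.HeightOneSpectrum.primesEquiv (R := 𝓞 ℚ)).symm ⟨p, hp.out⟩).Extension (𝓞 L))
  [he : Fact (w.1.asIdeal.ramificationIdx (𝓞 ℚ) = 1)] [Algebra ℚ (Kw p L w)]
  (W : WeierstrassCurve ℚ) [W.IsElliptic] [W.IsGloballyMinimal]
  [h₁ : (W.baseChange (Kw p L w)).IsIntegral (NormedField.valuation (K := Kw p L w)).integer]

/-- ★ **RECEPTACLE EXIT in (S5b)'s literal currency AT THE CYCLOTOMIC COMPLETION `K_w`.** `W/ℚ` globally minimal,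
`Addv W p`, `5 ≤ p`, `L/ℚ` `{m}`-cyclotomic, `w ∣ p ∤ m` (`e(w∣p) = 1`), F″'s clause AS TYPED
`7 < p ∨ (Nat.Coprime (orderOf (p : ZMod m)) (p − 1) ∧ ∀ P : (W.baseChange ℚ_[p]).Point, p • P = 0 → P = 0)`: if
`‖Tr_{K_w/ℚ_p}(a · padicLogPointFiniteExt ‖·‖ (W.baseChange K_w) p P)‖ ≤ 1` for every `P : (W.baseChange K_w).toAffine.Point`
(= the RHS of (S5b) at `F := K_w`, `w := NormedField.valuation`, any `ℚ`-algebra structure on `K_w`), then `‖a‖ ≤ 1` — Kim–Nakamura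
Cor. 2.4 at every datum of F″, modulo instantiating (S5b) at `K_w`. [cite: KimNakamura2020, Cor. 2.4]
[cite: KostersPannekoek2017, Thm. 1 and Cor. 2] [cite: Kato2004Asterisque, (8.1.3), Thm. 9.7 (the consumer)] -/
theorem norm_le_one_of_forall_point_baseChange_Kw_of_katoClause (m : ℕ) [NeZero m] [IsCyclotomicExtension {m} ℚ L]
    (hpm : ¬ p ∣ m) (hp5 : 5 ≤ p) (hadd : Rank1Residual.Addv W p)
    (hcl : 7 < p ∨ (Nat.Coprime (orderOf (p : ZMod m)) (p - 1) ∧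
      ∀ P : (W.baseChange ℚ_[p]).toAffine.Point, p • P = 0 → P = 0))
    {a : Kw p L w}
    (ha : ∀ P : (W.baseChange (Kw p L w)).toAffine.Point,
      ‖Algebra.trace ℚ_[p] (Kw p L w) (a * padicLogPointFiniteExt (NormedField.valuation (K := Kw p L w))
        (W.baseChange (Kw p L w)) p P)‖ ≤ 1) :
    ‖a‖ ≤ 1 := by
  haveI := isIntegral_curveK p (Kw p L w) ((integralModelInt W).map (Int.castRingHom ℤ_[p]))
  exact norm_le_one_of_forall_point_Kw_of_katoClause p L w W m hpm hp5 hadd hcl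
    (forall_trace_curveK_of_forall_trace_baseChange (p := p) W ha)

/-- (S5b)-socket form AT `K_w`: any `Φ : X → K_w` whose range is characterised by (S5b)'s literal condition on
`W.baseChange K_w` takes values in `𝒪_w` — `exp*_{e•ω}(H¹(K_w, T_pW)) ⊆ 𝒪_w`. [cite: KimNakamura2020, Cor. 2.4]
[cite: BlochKato1990, Prop. 3.8] -/
theorem forall_norm_le_one_of_range_iff_forall_point_baseChange_Kw_of_katoClause (m : ℕ) [NeZero m]
    [IsCyclotomicExtension {m} ℚ L] (hpm : ¬ p ∣ m) (hp5 : 5 ≤ p) (hadd : Rank1Residual.Addv W p)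
    (hcl : 7 < p ∨ (Nat.Coprime (orderOf (p : ZMod m)) (p - 1) ∧
      ∀ P : (W.baseChange ℚ_[p]).toAffine.Point, p • P = 0 → P = 0))
    {X : Type*} (Φ : X → Kw p L w)
    (hΦ : ∀ a : Kw p L w, (∃ x, Φ x = a) ↔ ∀ P : (W.baseChange (Kw p L w)).toAffine.Point,
      ‖Algebra.trace ℚ_[p] (Kw p L w) (a * padicLogPointFiniteExt (NormedField.valuation (K := Kw p L w))
        (W.baseChange (Kw p L w)) p P)‖ ≤ 1)
    (x : X) : ‖Φ x‖ ≤ 1 :=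
  norm_le_one_of_forall_point_baseChange_Kw_of_katoClause p L w W m hpm hp5 hadd hcl ((hΦ (Φ x)).mp ⟨x, rfl⟩)

end ExitKw

end Summit.BirchSwinnertonDyer.BirchSwinnertonDyer.Theorems.ReceptacleTorsion

end
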